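import Mathlib.CategoryTheory.Limits.Types.Coequalizers
import Mathlib.CategoryTheory.Limits.Shapes.FiniteLimits
import Mathlib.CategoryTheory.Limits.Preserves.Shapes.Equalizers
import Literature.AnabelianGeometry.SemiGraphs.BTempLimitsProofs
import HarnessLib

/-!
# Semi-graphs of anabelioids, §3 / Appendix Thm. A.4 (Čech route): coequalizers of `B^temp(Π)`
# on points

Mochizuki, *Semi-graphs of anabelioids*, Publ. RIMS **42** (2006) 221–322, §3, Definition 3.1 (iii)
p. 33 [cite: MochizukiSemiAnbd2006, Def 3.1(iii) p.33] (temperoids possess countable colimits; in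
`B^temp(Π)` they are computed on underlying sets, `BTempLimitsProofs.lean`) and Appendix, Theorem A.4
pp. 82–86 [cite: MochizukiSemiAnbd2006, Thm A.4 pp.82-86], whose Čech-route existence proof (row
A4-∃ of `plan/L3/SUBDAG-SemiAnbd-Cor311.md`, cut of abc-iut-w5-d129; file E3
`QuasiTemperoidsThmA4CechLimits.lean`) computes `ψ^*(X) = coeq(φ^*(X × A × A) ⇉ φ^*(X × A))` ON
POINTS as the quotient of the points of `φ^*(X × A)` by the image relation.

This proof-only TOOL file (seat abc-iut-w4-d081) records that computation for an arbitrary parallel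
pair `f, g : K ⇉ P` of `B^temp(Π)` and a colimit cofork `π : P → Z` (`IsColimit (Cofork.ofπ π w)`):

* `BTemp.cofork_π_surjective` — `π` is surjective on points;
* `BTemp.cofork_π_apply_eq_iff` — `π x = π y ↔` `x`, `y` are related by the EQUIVALENCE RELATION
  GENERATED by the image relation `x ∼ y :⟺ ∃ k, f k = x ∧ g k = y` (`Relation.EqvGen`);
* `BTemp.cofork_π_apply_eq_iff_of_equivalence` — when the image relation is already an equivalence
  relation (the case of an injective equivalence relation `K ↪ P × P`, as for the image of a Čech
  nerve under a finite-limit-preserving functor), `π x = π y ↔ ∃ k, f k = x ∧ g k = y`.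

Proof: the forgetful functor `B^temp(Π) ⥤ Type` preserves countable colimits
(`BTemp.preservesColimitsOfShape_forget`), and a coequalizer of types is the quotient by the generated
equivalence relation (`Types.coequalizerColimit`, `Quot.eq`).  Elementary; nothing refers to the IUT
corpus; no side is taken on any disputed claim.
-/

open CategoryTheory CategoryTheory.Limits

namespace Literature.AnabelianGeometry.SemiGraphs

namespace BTemp

universe u

variable {G : Type u} [Group G] [TopologicalSpace G] [IsTopologicalGroup G]
  {K P Z : BTemp G} {f g : K ⟶ P} {π : P ⟶ Z} (w : f ≫ π = g ≫ π)

/-- The IMAGE RELATION of a parallel pair `f, g : K ⇉ P` on the points of `P`: `x ∼ y` iff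
`(x, y) = (f k, g k)` for some point `k` of `K`. [cite: MochizukiSemiAnbd2006, Thm A.4 pp.82-86] -/
def PairRel (f g : K ⟶ P) (x y : P.obj.V) : Prop :=
  ∃ k : K.obj.V, (f.hom.hom k : P.obj.V) = x ∧ (g.hom.hom k : P.obj.V) = y

omit [IsTopologicalGroup G] in
/-- The image relation is Mathlib's generating relation of the coequalizer of the underlying maps.
[cite: MochizukiSemiAnbd2006, Thm A.4 pp.82-86] -/
theorem pairRel_iff_rel (f g : K ⟶ P) (x y : P.obj.V) :
    PairRel f g x y ↔
      Function.Coequalizer.Rel (fun k : K.obj.V => (f.hom.hom k : P.obj.V))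
        (fun k : K.obj.V => (g.hom.hom k : P.obj.V)) x y := by
  constructor
  · rintro ⟨k, rfl, rfl⟩
    exact Function.Coequalizer.Rel.intro k
  · rintro ⟨k⟩
    exact ⟨k, rfl, rfl⟩

/-- The forgetful functor `B^temp(Π) ⥤ Type` preserves coequalizers (countable colimits are computed
on underlying sets). [cite: MochizukiSemiAnbd2006, Def 3.1(iii) p.33] -/
theorem preservesColimit_parallelPair_forget (f g : K ⟶ P) :
    PreservesColimit (parallelPair f g) ((temperedAction G).ι ⋙ Action.forget (Type u) G) := by
  haveI := BTemp.preservesColimitsOfShape_forget (G := G) WalkingParallelPair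
  infer_instance

/-- The underlying cofork of types of a colimit cofork of `B^temp(Π)` is a colimit.
[cite: MochizukiSemiAnbd2006, Def 3.1(iii) p.33] -/
noncomputable def isColimitCoforkForget (hc : IsColimit (Cofork.ofπ π w)) :
    IsColimit (Cofork.ofπ (((temperedAction G).ι ⋙ Action.forget (Type u) G).map π)
      (by simp only [← Functor.map_comp, w]) :
      Cofork (((temperedAction G).ι ⋙ Action.forget (Type u) G).map f)
        (((temperedAction G).ι ⋙ Action.forget (Type u) G).map g)) :=
  haveI := preservesColimit_parallelPair_forget f g
  isColimitCoforkMapOfIsColimit ((temperedAction G).ι ⋙ Action.forget (Type u) G) w hc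

/-- The comparison BIJECTION between the points of a colimit cofork of `B^temp(Π)` and the quotient of
the points of `P` by the generated equivalence relation, with `π` going to the class map.
[cite: MochizukiSemiAnbd2006, Thm A.4 pp.82-86] -/
theorem exists_equiv_coequalizer (hc : IsColimit (Cofork.ofπ π w)) :
    ∃ e : Z.obj.V ≃ Function.Coequalizer (fun k : K.obj.V => (f.hom.hom k : P.obj.V))
        (fun k : K.obj.V => (g.hom.hom k : P.obj.V)),
      ∀ x : P.obj.V, e (π.hom.hom x) = Function.Coequalizer.mk _ _ x := by
  let U := (temperedAction G).ι ⋙ Action.forget (Type u) G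
  have h1 : IsColimit (Cofork.ofπ (U.map π) (by simp only [← Functor.map_comp, w]) :
      Cofork (U.map f) (U.map g)) := isColimitCoforkForget w hc
  -- the coequalizer of types over the same parallel pair `(U f, U g)`
  let h2 := (Types.coequalizerColimit (U.map f) (U.map g)).isColimit
  let e := h1.coconePointUniqueUpToIso h2
  refine ⟨e.toEquiv, fun x => ?_⟩
  have h := h1.comp_coconePointUniqueUpToIso_hom h2 WalkingParallelPair.one
  exact ConcreteCategory.congr_hom h x

/-- **A colimit cofork `π : P → Z` of `B^temp(Π)` is surjective on points.**
[cite: MochizukiSemiAnbd2006, Thm A.4 pp.82-86] -/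
theorem cofork_π_surjective (hc : IsColimit (Cofork.ofπ π w)) :
    Function.Surjective fun x : P.obj.V => (π.hom.hom x : Z.obj.V) := by
  obtain ⟨e, he⟩ := exists_equiv_coequalizer w hc
  intro z
  obtain ⟨x, hx⟩ := Function.Coequalizer.mk_surjective _ _ (e z)
  refine ⟨x, e.injective ?_⟩
  rw [he x, hx]

/-- **The fibres of a colimit cofork `π : P → Z` of `B^temp(Π)`**: `π x = π y` iff `x`, `y` are related
by the equivalence relation generated by the image relation of `(f, g)`.
[cite: MochizukiSemiAnbd2006, Thm A.4 pp.82-86] -/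
theorem cofork_π_apply_eq_iff (hc : IsColimit (Cofork.ofπ π w)) {x y : P.obj.V} :
    (π.hom.hom x : Z.obj.V) = π.hom.hom y ↔ Relation.EqvGen (PairRel f g) x y := by
  obtain ⟨e, he⟩ := exists_equiv_coequalizer w hc
  have hrel : PairRel f g = Function.Coequalizer.Rel (fun k : K.obj.V => (f.hom.hom k : P.obj.V))
      (fun k : K.obj.V => (g.hom.hom k : P.obj.V)) := by
    funext x y
    exact propext (pairRel_iff_rel f g x y)
  rw [← e.injective.eq_iff, he x, he y, hrel]
  exact Quot.eq

/-- **When the image relation is already an equivalence relation** (e.g. the image of a Čech nerve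
under a functor preserving finite limits), the fibres of the colimit cofork ARE the image relation:
`π x = π y ↔ ∃ k, f k = x ∧ g k = y`. [cite: MochizukiSemiAnbd2006, Thm A.4 pp.82-86] -/
theorem cofork_π_apply_eq_iff_of_equivalence (hc : IsColimit (Cofork.ofπ π w))
    (hR : Equivalence (PairRel f g)) {x y : P.obj.V} :
    (π.hom.hom x : Z.obj.V) = π.hom.hom y ↔ PairRel f g x y := by
  rw [cofork_π_apply_eq_iff w hc, hR.eqvGen_iff]

/-- The same three facts for THE coequalizer `coequalizer f g` of `B^temp(Π)` (which exists:
`B^temp(Π)` has countable colimits). [cite: MochizukiSemiAnbd2006, Def 3.1(iii) p.33] -/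
theorem coequalizer_π_apply_eq_iff [HasCoequalizer f g] {x y : P.obj.V} :
    ((coequalizer.π f g).hom.hom x : (coequalizer f g).obj.V) = (coequalizer.π f g).hom.hom y ↔
      Relation.EqvGen (PairRel f g) x y :=
  cofork_π_apply_eq_iff (coequalizer.condition f g) (coequalizerIsCoequalizer f g)

/-- `coequalizer.π` of `B^temp(Π)` is surjective on points. [cite: MochizukiSemiAnbd2006, Def 3.1(iii) p.33] -/
theorem coequalizer_π_surjective [HasCoequalizer f g] :
    Function.Surjective fun x : P.obj.V =>
      ((coequalizer.π f g).hom.hom x : (coequalizer f g).obj.V) :=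
  cofork_π_surjective (coequalizer.condition f g) (coequalizerIsCoequalizer f g)

omit [IsTopologicalGroup G] in
/-- Points of the arrow descended from a colimit cofork: `desc ∘ π = u` on points.
[cite: MochizukiSemiAnbd2006, Thm A.4 pp.82-86] -/
theorem cofork_desc_apply (hc : IsColimit (Cofork.ofπ π w)) {W : BTemp G} (u : P ⟶ W)
    (hu : f ≫ u = g ≫ u) (x : P.obj.V) :
    ((hc.desc (Cofork.ofπ u hu)).hom.hom (π.hom.hom x) : W.obj.V) = u.hom.hom x := by
  have h := hc.fac (Cofork.ofπ u hu) WalkingParallelPair.one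
  rw [Cofork.ofπ_ι_app, Cofork.ofπ_ι_app] at h
  exact congrArg (fun φ : P ⟶ W => (φ.hom.hom x : W.obj.V)) h

end BTemp

end Literature.AnabelianGeometry.SemiGraphs
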